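import Mathlib
import Literature.Computability.AlgebraicComplexity.PermanentIrreducible
import Literature.Computability.AlgebraicComplexity.StandardFamiliesProofs
import Summits.ValiantsHypothesis.ValiantsHypothesis.Theorems.DivisionGapPerCofactorDegreeReductionStubPositivityThreshold

/-!
# Crux `DivisionGap.PerCofactorDegreeReduction` (stmt-ValiantsHypothesis-15046), line `Sketch` —
# stub `stub_parityCofactor`: the global signed family `q_par = (per⁺)² − per⁺·per⁻ + (per⁻)²`

**Theorem (`stub_parityCofactor`).**  Let `n ≥ 2` and split the permanent by parity:
`a := per⁺_n = Σ_{σ even} x^{μ_σ}`, `b := per⁻_n = Σ_{σ odd} x^{μ_σ}` (real coefficients,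
`n × n` variables, `μ_σ` the exponent of the permutation monomial `∏_i x_{σ i, i}`).  Then
* `a + b = per_n`;
* `per_n · (a² − ab + b²) = a³ + b³`, and every coefficient of `a³ + b³` is `≥ 0`;
* `q_par := a² − ab + b²` is SIGNED: its coefficient at `M := μ_id + μ_{(0 1)}` is `−1 < 0`;
* `deg q_par ≤ 2n`.
So `q_par` is a signed real cofactor of degree `2n` with `per_n · q_par ≥ 0` for every `n ≥ 2`
(at `n = 2` it is the disprover's `q₂ = a² − ab + b²`, `a = x₀₀x₁₁`, `b = x₀₁x₁₀`).

## Proof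

* **Parity split** (`sum_even_add_sum_odd`).  `sign σ ∈ {1, −1}` and `1 ≠ −1` in `ℤˣ`
  (`Int.units_ne_iff_eq_neg`), so the odd permutations are exactly the non-even ones and
  `per_n = Σ_σ x^{μ_σ}` (`perPoly_eq_sum_monomial`) splits as `a + b`
  (`Finset.sum_filter_add_sum_filter_not`); then `per_n · (a² − ab + b²) = (a + b)(a² − ab + b²)
  = a³ + b³` by `ring`.
* **Positivity.**  `a`, `b` are sums of monomials with coefficient `1`, and products, powers and
  sums of polynomials with nonnegative coefficients have nonnegative coefficients (`coeff_mul` is a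
  sum of products of coefficients): `coeff_mul_nonneg`, `coeff_pow_nonneg`.
* **The negative coefficient** (`eq_of_add_eq`, the combinatorial heart).  If
  `μ_σ + μ_ρ = μ_id + μ_τ` with `τ = (i₀ i₁)`, `i₀ ≠ i₁`, then `(σ, ρ) = (id, τ)` or `(τ, id)`.
  Reading the exponent equation at the cell `(σ c, c)` (`indicator_add_eq`, via
  `permMonomial_apply : μ_ρ (r, c) = [ρ c = r]`) shows `σ c ∈ {c, τ c}` for every column `c`.
  If `σ` fixes `i₀`, it cannot send `i₁` to `τ i₁ = i₀` (injectivity), so it fixes `i₁`, and it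
  fixes every other column `c` (where `τ c = c`): `σ = id`; then the equation at `(ρ c, c)` reads
  `[ρ c = c] + 1 = [ρ c = c] + [τ c = ρ c]`, so `ρ = τ` (`eq_one_of_add_eq`).  If `σ` moves `i₀`,
  the cell `(i₀, i₀)` gives `[σ i₀ = i₀] + [ρ i₀ = i₀] = 1 + [i₁ = i₀] = 1`, so `ρ` fixes `i₀` and
  the roles swap.  Expanding `(Σ_{σ ∈ E} x^{μ_σ})(Σ_{ρ ∈ O} x^{μ_ρ}) = Σ_{σ ∈ E, ρ ∈ O}
  x^{μ_σ + μ_ρ}` (`coeff_sum_mul_sum`), the coefficient at `M` counts the pairs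
  `(σ, ρ) ∈ E × O` with `{σ, ρ} = {id, τ}`; as `id` is even (`sign_one`) and `τ` is odd
  (`sign_swap`), this count is `0` for `a·a` and `b·b` (`coeff_sq_eq_zero`) and `1` for `a·b`
  (`coeff_cross_eq_one`), whence `coeff M q_par = 0 − 1 + 0 = −1`.
* **Degree.**  `deg μ_σ = n` (`PositivityThreshold.degree_permMonomial`), so `deg a, deg b ≤ n`
  (`totalDegree_finsetSum_le`) and `deg q_par ≤ 2n` (`totalDegree_mul`, `totalDegree_sub`,
  `totalDegree_add`).

Design: no definitions; the whole statement is proved for an arbitrary transposition `(i₀ i₁)`,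
`i₀ ≠ i₁` (`parityCofactor`), and specialised to `(0 1)` in the stub.  Leans on Mathlib, the tree
file `Literature/Computability/AlgebraicComplexity/PermanentIrreducible.lean` (`permMonomial`,
`permMonomial_apply`, `perPoly_eq_sum_monomial`) and the landed stub file
`DivisionGapPerCofactorDegreeReductionStubPositivityThreshold.lean` (`degree_permMonomial`,
`totalDegree_monomial_le_degree`).
-/

noncomputable section

-- `Summit.ValiantsHypothesis.ValiantsHypothesis.…` is the tree's mandated single-conjunct layout
-- (Problem = Summit), so the duplicated namespace component is intended.
set_option linter.dupNamespace false

namespace Summit.ValiantsHypothesis.ValiantsHypothesis.Theorems.DivisionGap.PerCofactorDegreeReduction.ParityCofactor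

open MvPolynomial Literature.Computability.AlgebraicComplexity
open scoped BigOperators

variable {n : ℕ}

/-! ### Coefficient bookkeeping for sums of permutation monomials -/

/-- The product of two sums of permutation monomials, expanded: the coefficient at `d` counts the
pairs `(σ, ρ)` with `μ_σ + μ_ρ = d`. [folklore] -/
theorem coeff_sum_mul_sum (E O : Finset (Equiv.Perm (Fin n))) (d : (Fin n × Fin n) →₀ ℕ) :
    coeff d ((∑ σ ∈ E, monomial (permMonomial σ) (1 : ℝ)) *
        ∑ ρ ∈ O, monomial (permMonomial ρ) (1 : ℝ)) =
      ∑ σ ∈ E, ∑ ρ ∈ O, if permMonomial σ + permMonomial ρ = d then (1 : ℝ) else 0 := by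
  rw [Finset.sum_mul_sum, coeff_sum]
  refine Finset.sum_congr rfl fun σ _ => ?_
  rw [coeff_sum]
  refine Finset.sum_congr rfl fun ρ _ => ?_
  rw [monomial_mul, mul_one, coeff_monomial]

/-- A sum of permutation monomials with coefficient `1` has nonnegative coefficients. [folklore] -/
theorem coeff_sum_monomial_nonneg (E : Finset (Equiv.Perm (Fin n))) (d : (Fin n × Fin n) →₀ ℕ) :
    0 ≤ coeff d (∑ σ ∈ E, monomial (permMonomial σ) (1 : ℝ)) := by
  rw [coeff_sum]
  exact Finset.sum_nonneg fun σ _ => by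
    rw [coeff_monomial]
    split_ifs <;> norm_num

/-- A product of two polynomials with nonnegative coefficients has nonnegative coefficients
(`coeff_mul` is a sum of products of coefficients). [folklore] -/
theorem coeff_mul_nonneg {p q : MvPolynomial (Fin n × Fin n) ℝ} (hp : ∀ d, 0 ≤ coeff d p)
    (hq : ∀ d, 0 ≤ coeff d q) (d : (Fin n × Fin n) →₀ ℕ) : 0 ≤ coeff d (p * q) := by
  rw [coeff_mul]
  exact Finset.sum_nonneg fun x _ => mul_nonneg (hp _) (hq _)

/-- A power of a polynomial with nonnegative coefficients has nonnegative coefficients.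
[folklore] -/
theorem coeff_pow_nonneg {p : MvPolynomial (Fin n × Fin n) ℝ} (hp : ∀ d, 0 ≤ coeff d p) :
    ∀ (k : ℕ) (d : (Fin n × Fin n) →₀ ℕ), 0 ≤ coeff d (p ^ k)
  | 0, d => by
    rw [pow_zero, coeff_one]
    split_ifs <;> norm_num
  | k + 1, d => by
    rw [pow_succ]
    exact coeff_mul_nonneg (coeff_pow_nonneg hp k) hp d

/-- A sum of permutation monomials has total degree `≤ n` (`deg μ_σ = n`). [folklore] -/
theorem totalDegree_sum_monomial_le (E : Finset (Equiv.Perm (Fin n))) :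
    (∑ σ ∈ E, monomial (permMonomial σ) (1 : ℝ)).totalDegree ≤ n :=
  totalDegree_finsetSum_le fun σ _ =>
    (PositivityThreshold.totalDegree_monomial_le_degree _ _).trans
      (PositivityThreshold.degree_permMonomial σ).le

/-! ### The parity split of the permanent -/

/-- `per_n = per⁺_n + per⁻_n`: every permutation is even or odd, not both (`sign σ ∈ {±1}`,
`1 ≠ −1` in `ℤˣ`). [folklore] -/
theorem sum_even_add_sum_odd :
    (∑ σ ∈ Finset.univ.filter (fun σ : Equiv.Perm (Fin n) => Equiv.Perm.sign σ = 1),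
        monomial (permMonomial σ) (1 : ℝ)) +
      ∑ σ ∈ Finset.univ.filter (fun σ : Equiv.Perm (Fin n) => Equiv.Perm.sign σ = -1),
        monomial (permMonomial σ) (1 : ℝ) = perPoly (Fin n) ℝ := by
  have hO : Finset.univ.filter (fun σ : Equiv.Perm (Fin n) => Equiv.Perm.sign σ = -1) =
      Finset.univ.filter (fun σ : Equiv.Perm (Fin n) => ¬Equiv.Perm.sign σ = 1) :=
    Finset.filter_congr fun σ _ => Int.units_ne_iff_eq_neg.symm
  rw [hO, Finset.sum_filter_add_sum_filter_not, perPoly_eq_sum_monomial]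

/-! ### The combinatorial heart: `μ_σ + μ_ρ = μ_id + μ_{(i₀ i₁)}` forces `{σ, ρ} = {id, (i₀ i₁)}` -/

/-- The exponent equation `μ_σ + μ_ρ = μ_id + μ_τ`, `τ = (i₀ i₁)`, read at the cell `(r, c)`:
`[σ c = r] + [ρ c = r] = [c = r] + [τ c = r]` (`permMonomial_apply`). [folklore] -/
theorem indicator_add_eq {i₀ i₁ : Fin n} {σ ρ : Equiv.Perm (Fin n)}
    (h : permMonomial σ + permMonomial ρ =
      permMonomial 1 + permMonomial (Equiv.swap i₀ i₁)) (r c : Fin n) :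
    (if σ c = r then 1 else 0) + (if ρ c = r then 1 else 0) =
      (if c = r then 1 else 0) + (if Equiv.swap i₀ i₁ c = r then (1 : ℕ) else 0) := by
  have := DFunLike.congr_fun h (r, c)
  rw [Finsupp.add_apply, Finsupp.add_apply, permMonomial_apply, permMonomial_apply,
    permMonomial_apply, permMonomial_apply, Equiv.Perm.one_apply] at this
  exact this

/-- If `μ_σ + μ_ρ = μ_id + μ_τ` (`τ = (i₀ i₁)`, `i₀ ≠ i₁`) and `σ` fixes `i₀`, then `σ = id` and
`ρ = τ`.  Every column `c` of `σ` is the identity column or the `τ` column (cell `(σ c, c)`);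
`σ i₁ = τ i₁ = i₀ = σ i₀` is excluded by injectivity, and `τ c = c` off `{i₀, i₁}`, so `σ = id`;
then the cell `(ρ c, c)` reads `[ρ c = c] + 1 = [ρ c = c] + [τ c = ρ c]`. [folklore] -/
theorem eq_one_of_add_eq {i₀ i₁ : Fin n} (h01 : i₀ ≠ i₁) {σ ρ : Equiv.Perm (Fin n)}
    (h : permMonomial σ + permMonomial ρ =
      permMonomial 1 + permMonomial (Equiv.swap i₀ i₁))
    (hσ : σ i₀ = i₀) : σ = 1 ∧ ρ = Equiv.swap i₀ i₁ := by
  -- every column of `σ` is the identity column or the `τ` column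
  have hA : ∀ c, σ c = c ∨ σ c = Equiv.swap i₀ i₁ c := fun c => by
    by_contra hc
    rw [not_or] at hc
    have := indicator_add_eq h (σ c) c
    rw [if_pos rfl, if_neg (Ne.symm hc.1), if_neg (Ne.symm hc.2)] at this
    split_ifs at this <;> omega
  -- `σ` fixes `i₀`, hence `i₁` (injectivity), hence every column
  have hσ1 : σ = 1 := by
    refine Equiv.ext fun c => ?_
    rw [Equiv.Perm.one_apply]
    rcases hA c with hc | hc
    · exact hc
    by_cases hc0 : c = i₀
    · rw [hc0, hσ]
    by_cases hc1 : c = i₁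
    · rw [hc1] at hc ⊢
      rw [Equiv.swap_apply_right] at hc
      exact absurd (σ.injective (hc.trans hσ.symm)) (Ne.symm h01)
    · rw [hc, Equiv.swap_apply_of_ne_of_ne hc0 hc1]
  subst hσ1
  -- now `μ_ρ = μ_τ` cell by cell
  refine ⟨rfl, Equiv.ext fun c => ?_⟩
  by_contra hc
  have := indicator_add_eq h (ρ c) c
  rw [Equiv.Perm.one_apply, if_pos rfl, if_neg (Ne.symm hc)] at this
  split_ifs at this <;> omega

/-- **Key lemma.**  If `μ_σ + μ_ρ = μ_id + μ_τ` with `τ = (i₀ i₁)`, `i₀ ≠ i₁`, then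
`(σ, ρ) = (id, τ)` or `(σ, ρ) = (τ, id)`: the cell `(i₀, i₀)` reads
`[σ i₀ = i₀] + [ρ i₀ = i₀] = 1`, so exactly one of `σ`, `ρ` fixes `i₀`, and `eq_one_of_add_eq`
applies to it. [folklore] -/
theorem eq_of_add_eq {i₀ i₁ : Fin n} (h01 : i₀ ≠ i₁) {σ ρ : Equiv.Perm (Fin n)}
    (h : permMonomial σ + permMonomial ρ =
      permMonomial 1 + permMonomial (Equiv.swap i₀ i₁)) :
    (σ = 1 ∧ ρ = Equiv.swap i₀ i₁) ∨ (σ = Equiv.swap i₀ i₁ ∧ ρ = 1) := by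
  by_cases hσ : σ i₀ = i₀
  · exact Or.inl (eq_one_of_add_eq h01 h hσ)
  · -- the cell `(i₀, i₀)`: one of `σ`, `ρ` fixes `i₀`
    have hρ : ρ i₀ = i₀ := by
      by_contra hρ
      have := indicator_add_eq h i₀ i₀
      rw [Equiv.swap_apply_left, if_neg hσ, if_neg hρ, if_neg (Ne.symm h01), if_pos rfl] at this
      omega
    rw [add_comm] at h
    obtain ⟨h1, h2⟩ := eq_one_of_add_eq h01 h hρ
    exact Or.inr ⟨h2, h1⟩

/-! ### The three coefficients at `M = μ_id + μ_{(i₀ i₁)}` -/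

/-- The square `(Σ_{σ ∈ E} x^{μ_σ})²` vanishes at `M = μ_id + μ_τ` as soon as `E` misses `τ` or
`id`: a contributing pair `{σ, ρ} ⊆ E` would be `{id, τ}` (`eq_of_add_eq`). [folklore] -/
theorem coeff_sq_eq_zero {i₀ i₁ : Fin n} (h01 : i₀ ≠ i₁) {E : Finset (Equiv.Perm (Fin n))}
    (hE : Equiv.swap i₀ i₁ ∉ E ∨ (1 : Equiv.Perm (Fin n)) ∉ E) :
    coeff (permMonomial 1 + permMonomial (Equiv.swap i₀ i₁))
      ((∑ σ ∈ E, monomial (permMonomial σ) (1 : ℝ)) *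
        ∑ σ ∈ E, monomial (permMonomial σ) (1 : ℝ)) = 0 := by
  rw [coeff_sum_mul_sum]
  refine Finset.sum_eq_zero fun σ hσ => Finset.sum_eq_zero fun ρ hρ => if_neg fun h => ?_
  rcases eq_of_add_eq h01 h with ⟨rfl, rfl⟩ | ⟨rfl, rfl⟩
  · exact hE.elim (fun h' => h' hρ) (fun h' => h' hσ)
  · exact hE.elim (fun h' => h' hσ) (fun h' => h' hρ)

/-- The cross term `(Σ_{σ ∈ E} x^{μ_σ})(Σ_{ρ ∈ O} x^{μ_ρ})` has coefficient exactly `1` at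
`M = μ_id + μ_τ` when `id ∈ E`, `τ ∉ E`, `τ ∈ O`: the only contributing pair is `(id, τ)`
(`eq_of_add_eq`). [folklore] -/
theorem coeff_cross_eq_one {i₀ i₁ : Fin n} (h01 : i₀ ≠ i₁) {E O : Finset (Equiv.Perm (Fin n))}
    (h1E : (1 : Equiv.Perm (Fin n)) ∈ E) (hτE : Equiv.swap i₀ i₁ ∉ E)
    (hτO : Equiv.swap i₀ i₁ ∈ O) :
    coeff (permMonomial 1 + permMonomial (Equiv.swap i₀ i₁))
      ((∑ σ ∈ E, monomial (permMonomial σ) (1 : ℝ)) *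
        ∑ ρ ∈ O, monomial (permMonomial ρ) (1 : ℝ)) = 1 := by
  rw [coeff_sum_mul_sum, Finset.sum_eq_single_of_mem 1 h1E]
  · rw [Finset.sum_eq_single_of_mem _ hτO]
    · exact if_pos rfl
    · intro ρ _ hne
      refine if_neg fun h => ?_
      rcases eq_of_add_eq h01 h with ⟨-, h2⟩ | ⟨h2, -⟩
      · exact hne h2
      · exact hτE (h2 ▸ h1E)
  · intro σ hσ hne
    refine Finset.sum_eq_zero fun ρ _ => if_neg fun h => ?_
    rcases eq_of_add_eq h01 h with ⟨h2, -⟩ | ⟨h2, -⟩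
    · exact hne h2
    · exact hτE (h2 ▸ hσ)

/-! ### The stub -/

/-- **The parity cofactor for an arbitrary transposition `(i₀ i₁)`, `i₀ ≠ i₁`.**  With
`a = per⁺_n`, `b = per⁻_n`: `a + b = per_n`, `per_n · (a² − ab + b²) = a³ + b³ ≥ 0`
coefficientwise, `coeff_{μ_id + μ_{(i₀ i₁)}} (a² − ab + b²) = 0 − 1 + 0 < 0`, and
`deg (a² − ab + b²) ≤ 2n`. [prime-walk-positivizer, K2 window] -/
theorem parityCofactor {i₀ i₁ : Fin n} (h01 : i₀ ≠ i₁) (a b : MvPolynomial (Fin n × Fin n) ℝ)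
    (ha : a = ∑ σ ∈ Finset.univ.filter (fun σ : Equiv.Perm (Fin n) => Equiv.Perm.sign σ = 1),
      monomial (permMonomial σ) 1)
    (hb : b = ∑ σ ∈ Finset.univ.filter (fun σ : Equiv.Perm (Fin n) => Equiv.Perm.sign σ = -1),
      monomial (permMonomial σ) 1) :
    a + b = perPoly (Fin n) ℝ ∧
    perPoly (Fin n) ℝ * (a * a - a * b + b * b) = a ^ 3 + b ^ 3 ∧
    (∀ d, 0 ≤ coeff d (a ^ 3 + b ^ 3)) ∧
    coeff (permMonomial 1 + permMonomial (Equiv.swap i₀ i₁)) (a * a - a * b + b * b) < 0 ∧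
    (a * a - a * b + b * b).totalDegree ≤ 2 * n := by
  -- (1) the parity split
  have hab : a + b = perPoly (Fin n) ℝ := by
    rw [ha, hb]
    exact sum_even_add_sum_odd
  -- (3) nonnegative coefficients
  have haN : ∀ d, 0 ≤ coeff d a := fun d => by
    rw [ha]
    exact coeff_sum_monomial_nonneg _ d
  have hbN : ∀ d, 0 ≤ coeff d b := fun d => by
    rw [hb]
    exact coeff_sum_monomial_nonneg _ d
  -- (4) parities of `id` and `τ`
  have hu : (1 : ℤˣ) ≠ -1 := by decide
  have h1E : (1 : Equiv.Perm (Fin n)) ∈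
      Finset.univ.filter (fun σ : Equiv.Perm (Fin n) => Equiv.Perm.sign σ = 1) :=
    Finset.mem_filter.2 ⟨Finset.mem_univ _, Equiv.Perm.sign_one⟩
  have hτE : Equiv.swap i₀ i₁ ∉
      Finset.univ.filter (fun σ : Equiv.Perm (Fin n) => Equiv.Perm.sign σ = 1) := fun h =>
    hu ((Finset.mem_filter.1 h).2.symm.trans (Equiv.Perm.sign_swap h01))
  have hτO : Equiv.swap i₀ i₁ ∈
      Finset.univ.filter (fun σ : Equiv.Perm (Fin n) => Equiv.Perm.sign σ = -1) :=
    Finset.mem_filter.2 ⟨Finset.mem_univ _, Equiv.Perm.sign_swap h01⟩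
  have h1O : (1 : Equiv.Perm (Fin n)) ∉
      Finset.univ.filter (fun σ : Equiv.Perm (Fin n) => Equiv.Perm.sign σ = -1) := fun h =>
    hu (Equiv.Perm.sign_one.symm.trans (Finset.mem_filter.1 h).2)
  have hM : coeff (permMonomial 1 + permMonomial (Equiv.swap i₀ i₁)) (a * a - a * b + b * b) =
      -1 := by
    rw [coeff_add, coeff_sub, ha, hb, coeff_sq_eq_zero h01 (Or.inl hτE),
      coeff_cross_eq_one h01 h1E hτE hτO, coeff_sq_eq_zero h01 (Or.inr h1O)]
    norm_num
  -- (5) degrees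
  have hmul : ∀ p q : MvPolynomial (Fin n × Fin n) ℝ, p.totalDegree ≤ n → q.totalDegree ≤ n →
      (p * q).totalDegree ≤ 2 * n := fun p q hp hq =>
    (totalDegree_mul p q).trans (by omega)
  have hdA : a.totalDegree ≤ n := by
    rw [ha]
    exact totalDegree_sum_monomial_le _
  have hdB : b.totalDegree ≤ n := by
    rw [hb]
    exact totalDegree_sum_monomial_le _
  refine ⟨hab, by rw [← hab]; ring, fun d => ?_, by rw [hM]; norm_num, ?_⟩
  · rw [coeff_add]
    exact add_nonneg (coeff_pow_nonneg haN 3 d) (coeff_pow_nonneg hbN 3 d)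
  · exact (totalDegree_add _ _).trans (max_le ((totalDegree_sub _ _).trans
      (max_le (hmul a a hdA hdA) (hmul a b hdA hdB))) (hmul b b hdB hdB))

/-- **stub_parityCofactor — the global signed family `q_par = (per⁺)² − per⁺ per⁻ + (per⁻)²`.**
For every `n ≥ 2`, with `a := per⁺_n = Σ_{σ even} x^{μ_σ}` and `b := per⁻_n = Σ_{σ odd} x^{μ_σ}`:
`a + b = per_n`, `per_n · (a² − ab + b²) = a³ + b³` has nonnegative coefficients, the coefficient of
`q_par := a² − ab + b²` at `μ_id + μ_{(0 1)}` is `−1 < 0` (the only pair of permutation monomials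
summing to `μ_id + μ_{(0 1)}` is `{id, (0 1)}`, one even and one odd), and `deg q_par ≤ 2n`.
Specialisation of `parityCofactor` to the transposition `(0 1)`.
[prime-walk-positivizer, K2 window] -/
theorem stub_parityCofactor (n : ℕ) (hn : 2 ≤ n) (a b : MvPolynomial (Fin n × Fin n) ℝ)
    (ha : a = ∑ σ ∈ Finset.univ.filter (fun σ : Equiv.Perm (Fin n) => Equiv.Perm.sign σ = 1),
      monomial (permMonomial σ) 1)
    (hb : b = ∑ σ ∈ Finset.univ.filter (fun σ : Equiv.Perm (Fin n) => Equiv.Perm.sign σ = -1),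
      monomial (permMonomial σ) 1) :
    a + b = perPoly (Fin n) ℝ ∧
    perPoly (Fin n) ℝ * (a * a - a * b + b * b) = a ^ 3 + b ^ 3 ∧
    (∀ d, 0 ≤ coeff d (a ^ 3 + b ^ 3)) ∧
    coeff (permMonomial 1 + permMonomial (Equiv.swap (⟨0, by omega⟩ : Fin n) ⟨1, by omega⟩))
      (a * a - a * b + b * b) < 0 ∧
    (a * a - a * b + b * b).totalDegree ≤ 2 * n := by
  have h01 : (⟨0, by omega⟩ : Fin n) ≠ ⟨1, by omega⟩ := by
    rw [Ne, Fin.mk.injEq]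
    omega
  exact parityCofactor h01 a b ha hb

end Summit.ValiantsHypothesis.ValiantsHypothesis.Theorems.DivisionGap.PerCofactorDegreeReduction.ParityCofactor

end
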